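import Summits.Ventures.Crystal3D.Theorems.StickyWulffConstantNoReconstructionGainCore
import HarnessLib

/-!
# Exact zero gain on rigid half-crystal faces — the objects of the line `replication-exactness` (definitions)

HONEST FRAMING. Part of the venture `Summits/Ventures/Crystal3D` (cell `crystal3d-full`), supports the
crux `NoReconstructionGain` (stmt-Ventures-19144, route `route-Ventures-StickyWulffConstant`), line
`replication-exactness` (crux-plan skeleton `Cruxes/NoReconstructionGain/Lines/replication_exactness.lean`,
triage r1 ×2 PASS; lead wulff-p1 g17).  DEFINITIONS ONLY — the ten notions of that skeleton, moved
verbatim (up to namespace) into the Theorems tree so that the line's stubs can be landed BY NAME: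

* `halfCrystal ν s` — the rigid half-crystal `H(ν,s) = Λ₀ ∩ {⟪p,ν⟫ ≤ s}` (`Λ₀ = fccStacking 1 √(2/3)`);
* `IsFilmOn ν s Q` — a FILM on `H(ν,s)`: finitely many ball centres, pairwise `≥ 1` apart, each
  `≥ 1` from every site of `H(ν,s)` (lattice sites above the cut may be film balls);
* `plugSet ν s q`, `plugCount ν s Q` — the substrate plugs of a ball (sites of `H(ν,s)` at distance
  exactly `1`) and the number `X(H,Q)` of substrate–film contacts of a film;
* `ExactZeroGain` — **EXACT₀**: `X(H,Q) ≤ D(Q) = 6·#Q − C(Q)` for every unit `ν`, every cut `s`, every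
  film (no radius, no constant: an integer statement about finite films);
* `IsCriminal ν s Q`, `NoCriminal` — EXACT₀ in minimal-counterexample normal form (a CRIMINAL is a
  nonempty film all of whose nonempty sub-blocks are strictly over-attached to substrate + rest);
* `OrientationCertificate` — Hakimi form: every film's contact graph has an orientation with
  `indeg + plug ≤ 6` at every ball;
* `CompatibleAdhesion R` — the adhesion atom of the crux chain with constant `0` on packings whose film
  stays at distance `≥ 1` from every slab site OFF the disc sample;
* `WrappedCoreAdhesion R C` — the residual "UNWRAP": the adhesion atom (`+ C ρ`) for P-cores (every
  nonempty block strictly over-attached, verbatim `adhesion_of_core`) that come within distance `< 1` of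
  a slab site off the sample.

The skeleton's composition (`NoReconstructionGain` from `NoCriminal` + the two sector statements, and
`NoReconstructionGain ↔ ExactZeroGain ↔ NoCriminal ↔ OrientationCertificate` modulo the residual) is
re-registered against these names.

WHAT THIS IS NOT: a theorem about packings — definitions only; nothing here proves the crux.
-/

noncomputable section

namespace Summit.Ventures.Crystal3D.Theorems

open Literature.MathematicalPhysics.StatisticalMechanics (fccStacking contactDeficiency)
open scoped InnerProductSpace
open Finset

/-! ## The exact objects: rigid half-crystal, films, plugs -/

/-- The rigid HALF-CRYSTAL below the cut: the sites of `Λ₀ = fccStacking 1 √(2/3)` of `ν`-height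
`≤ s`.  (The bottom face of a slab is the top face of `halfCrystal (-ν) (-s')`, so quantifying over
all unit `ν` and all `s` covers both faces.) -/
def halfCrystal (ν : EuclideanSpace ℝ (Fin 3)) (s : ℝ) : Set (EuclideanSpace ℝ (Fin 3)) :=
  {p | p ∈ fccStacking 1 (Real.sqrt (2 / 3)) ∧ ⟪p, ν⟫_ℝ ≤ s}

/-- A FILM on the half-crystal `H(ν,s)`: a finite set of ball centres, pairwise at distance `≥ 1`,
each at distance `≥ 1` from EVERY site of `H(ν,s)` (so `Q ∪ H(ν,s)` is a unit packing; lattice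
sites above the cut are allowed as film balls). -/
def IsFilmOn (ν : EuclideanSpace ℝ (Fin 3)) (s : ℝ) (Q : Finset (EuclideanSpace ℝ (Fin 3))) :
    Prop :=
  (∀ q ∈ Q, ∀ q' ∈ Q, q ≠ q' → 1 ≤ dist q q') ∧ ∀ q ∈ Q, ∀ p ∈ halfCrystal ν s, 1 ≤ dist q p

/-- The substrate PLUGS of one ball: sites of `H(ν,s)` at distance exactly `1` (a finite set:
`≤ 3` points if `q ∉ Λ₀` by `fcc_offLattice_unitContacts_le_three`, `≤ 12` always). -/
def plugSet (ν : EuclideanSpace ℝ (Fin 3)) (s : ℝ) (q : EuclideanSpace ℝ (Fin 3)) :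
    Set (EuclideanSpace ℝ (Fin 3)) :=
  {p | p ∈ halfCrystal ν s ∧ dist q p = 1}

/-- `X(H,Q)`: the number of substrate–film contacts of the film `Q`. -/
def plugCount (ν : EuclideanSpace ℝ (Fin 3)) (s : ℝ) (Q : Finset (EuclideanSpace ℝ (Fin 3))) : ℕ :=
  ∑ q ∈ Q, (plugSet ν s q).ncard

/-- **EXACT₀** — exact zero gain on every rigid half-crystal face: `X(H,Q) ≤ D(Q)`, i.e.
`C(Q) + X(H,Q) ≤ 6·#Q`, for every unit `ν`, every cut `s`, every film.  No radius, no constant: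
an integer statement about finite films. -/
def ExactZeroGain : Prop :=
  ∀ ν : EuclideanSpace ℝ (Fin 3), ‖ν‖ = 1 → ∀ s : ℝ, ∀ Q : Finset (EuclideanSpace ℝ (Fin 3)),
    IsFilmOn ν s Q → (plugCount ν s Q : ℝ) ≤ contactDeficiency Q

/-- A **CRIMINAL** (substrate-loaded strict core): a nonempty film every nonempty sub-block `U` of
which is STRICTLY over-attached — `D(U) < X(H,U) + e(Q∖U, U)`.  Taking `U = Q`: a criminal gains
(`D(Q) < X(H,Q)`); a gain-minimal gaining film is a criminal; in a criminal every ball has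
`plug + deg_Q ≥ 7`. -/
def IsCriminal (ν : EuclideanSpace ℝ (Fin 3)) (s : ℝ) (Q : Finset (EuclideanSpace ℝ (Fin 3))) :
    Prop :=
  IsFilmOn ν s Q ∧ Q.Nonempty ∧
    ∀ U : Finset (EuclideanSpace ℝ (Fin 3)), U ⊆ Q → U.Nonempty →
      contactDeficiency U <
        (plugCount ν s U : ℝ) + (((((Q \ U) ×ˢ U).filter fun pq => dist pq.1 pq.2 = 1).card : ℕ) : ℝ)

/-- **No criminal exists** — EXACT₀ in minimal-counterexample normal form. -/
def NoCriminal : Prop :=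
  ∀ ν : EuclideanSpace ℝ (Fin 3), ‖ν‖ = 1 → ∀ s : ℝ, ∀ Q : Finset (EuclideanSpace ℝ (Fin 3)),
    ¬ IsCriminal ν s Q

/-- **Hakimi form** (integral, rim-free flow certificate): the film's contact graph has an
orientation (`o q' q = 1` iff the bond `q'—q` points INTO `q`) with `indeg(q) + plug(q) ≤ 6` at
every ball.  With `t := o − oᵀ`, `E = ∅` this is the hypothesis of `adhesion_of_flow`. -/
def OrientationCertificate : Prop :=
  ∀ ν : EuclideanSpace ℝ (Fin 3), ‖ν‖ = 1 → ∀ s : ℝ, ∀ Q : Finset (EuclideanSpace ℝ (Fin 3)),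
    IsFilmOn ν s Q →
      ∃ o : EuclideanSpace ℝ (Fin 3) → EuclideanSpace ℝ (Fin 3) → ℕ,
        (∀ q ∈ Q, ∀ q' ∈ Q, dist q q' = 1 → o q q' + o q' q = 1) ∧
        ∀ q ∈ Q, (plugSet ν s q).ncard + ∑ q' ∈ Q.filter (fun q' => dist q q' = 1), o q' q ≤ 6

/-! ## The two halves of the adhesion atom, split by "does the film reach the off-sample slab?" -/

/-- **The adhesion atom with constant `0` on the S-COMPATIBLE sector**: for a unit packing `X`
containing the disc sample `P = P_ρ(ν,R)` whose film `X ∖ P` stays at distance `≥ 1` from every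
slab site OFF the sample, `#cross(P, X∖P) ≤ D(X∖P)` — no `C ρ` at all. -/
def CompatibleAdhesion (R : ℝ) : Prop :=
  ∀ ν : EuclideanSpace ℝ (Fin 3), ‖ν‖ = 1 → ∀ ρ : ℝ,
    ∀ X P : Finset (EuclideanSpace ℝ (Fin 3)),
    (∀ p ∈ X, ∀ q ∈ X, p ≠ q → 1 ≤ dist p q) → P ⊆ X →
    (∀ p, p ∈ P ↔ (p ∈ fccStacking 1 (Real.sqrt (2 / 3)) ∧ -(2 * R) ≤ ⟪p, ν⟫_ℝ ∧
      ⟪p, ν⟫_ℝ ≤ -R ∧ ‖p‖ ^ 2 - ⟪p, ν⟫_ℝ ^ 2 ≤ ρ ^ 2)) →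
    (∀ q ∈ X \ P, ∀ p ∈ fccStacking 1 (Real.sqrt (2 / 3)),
      -(2 * R) ≤ ⟪p, ν⟫_ℝ → ⟪p, ν⟫_ℝ ≤ -R → p ∉ P → 1 ≤ dist q p) →
    ((((P ×ˢ (X \ P)).filter fun pq => dist pq.1 pq.2 = 1).card : ℕ) : ℝ) ≤
      contactDeficiency (X \ P)

/-- **The residual "UNWRAP"**: the adhesion atom (`#cross ≤ D(X∖P) + C ρ`) restricted to packings whose
film is a P-CORE (every nonempty block strictly over-attached, as in `adhesion_of_core`) AND WRAPS —
some film ball comes within distance `< 1` of a slab site off the sample (occupies or crowds the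
collar).  This is the honest open remainder of the line `replication-exactness`. -/
def WrappedCoreAdhesion (R C : ℝ) : Prop :=
  ∀ ν : EuclideanSpace ℝ (Fin 3), ‖ν‖ = 1 → ∀ ρ : ℝ, R ≤ ρ →
    ∀ X P : Finset (EuclideanSpace ℝ (Fin 3)),
    (∀ p ∈ X, ∀ q ∈ X, p ≠ q → 1 ≤ dist p q) → P ⊆ X →
    (∀ p, p ∈ P ↔ (p ∈ fccStacking 1 (Real.sqrt (2 / 3)) ∧ -(2 * R) ≤ ⟪p, ν⟫_ℝ ∧
      ⟪p, ν⟫_ℝ ≤ -R ∧ ‖p‖ ^ 2 - ⟪p, ν⟫_ℝ ^ 2 ≤ ρ ^ 2)) →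
    (∃ q ∈ X \ P, ∃ p ∈ fccStacking 1 (Real.sqrt (2 / 3)),
      -(2 * R) ≤ ⟪p, ν⟫_ℝ ∧ ⟪p, ν⟫_ℝ ≤ -R ∧ p ∉ P ∧ dist q p < 1) →
    (∀ S, S ⊆ X \ P → S.Nonempty →
      contactDeficiency S <
        (((((X \ S) ×ˢ S).filter fun pq => dist pq.1 pq.2 = 1).card : ℕ) : ℝ)) →
    ((((P ×ˢ (X \ P)).filter fun pq => dist pq.1 pq.2 = 1).card : ℕ) : ℝ) ≤
      contactDeficiency (X \ P) + C * ρ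

end Summit.Ventures.Crystal3D.Theorems

end
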